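/-
Copyright (c) 2026. All rights reserved.
Released under Apache 2.0 license as described in the file LICENSE.
Authors: abc-iut cell, seat abc-iut-w5-d226 (gen 2; the `T = TM` / monoid-type column of abc-iut-L4-t10 g3's
Galois-category instance `AutHolLogFrobeniusGaloisModel.lean`, nodes AbsTopIII:Cor4.5 / Prop4.2(i) at the model).
-/
import Literature.AnabelianGeometry.AbsoluteAnabelian.ArchimedeanLogFrobeniusModelTM
import Literature.AnabelianGeometry.AbsoluteAnabelian.AbsTopIII.AutHolLogFrobeniusGaloisModel
import HarnessLib

/-!
# [AbsTopIII] Prop 4.2 (i) (monoid types) and Cor 4.5 (`T = TM`) at the Galois-category instance: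
# id-rigidity FROM SLIMNESS, unconditionally at `G := G_{ℚ_p}`

S. Mochizuki, *Topics in absolute anabelian geometry III*, Prop 4.2 (i) p. 105 / proof p. 106 l. 18–19 ("the
id-rigidity of `EA` follows immediately from the slimness assertion of Lemma 4.3"), Cor 4.5 pp. 107–110
("`𝒳 := 𝒞^hol_T` … `T ∈ {TM, TF}`"), kurims manuscript (lit key `paper:url-5493eb38cbb7`; bib key
`MochizukiAbsTopIII2015`).  PROOF-ONLY (nothing declared).

abc-iut-L4-t10 g3's `AutHolLogFrobeniusGaloisModel.lean` instantiates the interface `AutHolFieldFunctor` on a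
Galois category — `EA := B(G)` (hom-types lifted), `𝒜 := ℂ`, `𝒜_φ := id` — and proves `IsIdRigid EA` FROM
`IsSlimGroup G` (the printed route of Prop 4.2 (i)) and Cor 4.5 for `T = TF` there, unconditionally at
`G := G_{ℚ_p}`.  This file adds the monoid-type column (abc-iut-w5-d226's `HolMonoidPair`, `cor_4_5_arch_TM`):

* `HolMonoidPair.isIdRigid_ofGaloisCategory` — for `T ∈ {TM, TLG, TCG}` the category `𝒞^hol_T` over
  `B(G)` is id-rigid whenever `G` is slim (Prop 4.2 (i): `EA` id-rigid by slimness ⇒ `𝒞^hol_T = 𝒞̲^hol_T`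
  id-rigid), and its core is NOT id-rigid as soon as some `B(G)`-object has a nontrivial central
  automorphism (Rmk 4.2.1; `HolMonoidPair.not_isIdRigid_core`);
* `AbsTopIII.cor_4_5_arch_TM_ofGaloisCategory` — Cor 4.5 (i)–(v) for `𝒳 := 𝒞^hol_TM` over `B(G)`, `G` slim,
  from an object of `B(G)`;
* `AbsTopIII.cor_4_5_arch_TM_absoluteGaloisGroup_padic` — UNCONDITIONAL at `G := G_{ℚ_p}` (slim by
  [pGC] Lem 15.8 / the tree's `IsSubpadicFor.isSlimGroup_absoluteGaloisGroup`; object `G/G`).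

Honest scope, as in t10 g3's file: a MODEL instance (constant CAF `ℂ` on a Galois category); the geometric
`EA` of Cor 2.7 (G-w5d226-1) is not constructed, and the slim group of the unconditional example is
`G_{ℚ_p}`, not an archimedean `Π_X` (Lemma 4.3 stays FACT-policy at the geometric model).  Nothing here
bears on [IUTchIII] Cor. 3.12.
-/

set_option autoImplicit false

namespace Literature.AnabelianGeometry.AbsoluteAnabelian

open _root_.CategoryTheory
open Literature.AlgebraicGeometry.Frobenioids (IsSlimGroup BCat)
open Literature.AnabelianGeometry.Anabelioids (Induction.quotObj)

variable (G : Type) [Group G] [TopologicalSpace G]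

namespace HolMonoidPair

/-- **Prop 4.2 (i) for the monoid types at the Galois-category instance, FROM SLIMNESS**: for
`T ∈ {TM, TLG, TCG}` and `G` a slim profinite group, `𝒞^hol_T` over `EA := B(G)` is id-rigid.
[cite: MochizukiAbsTopIII2015, Proposition 4.2 (i) p.106] -/
theorem isIdRigid_ofGaloisCategory [IsTopologicalGroup G] [CompactSpace G] [T2Space G]
    [TotallyDisconnectedSpace G] {T : ArchPairType} (hT : T.IsMonoidType) (hG : IsSlimGroup G) :
    IsIdRigid (HolMonoidPair (AutHolFieldFunctor.ofGaloisCategory G) T) :=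
  isIdRigid_of_isIdRigid_EA hT (AutHolFieldFunctor.isIdRigid_EA_ofGaloisCategory hG)

/-- … while (Rmk 4.2.1) its groupoid version `Core 𝒞^hol_T` is NOT id-rigid as soon as some object of
`B(G)` has a nontrivial automorphism commuting with all its automorphisms.
[cite: MochizukiAbsTopIII2015, Remark 4.2.1 p.106] -/
theorem not_isIdRigid_core_ofGaloisCategory {T : ArchPairType} (hT : T.IsMonoidType)
    (X : (AutHolFieldFunctor.ofGaloisCategory G).EA) (z : X ≅ X) (hz : z ≠ Iso.refl X)
    (hc : ∀ g : X ≅ X, g ≪≫ z = z ≪≫ g) :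
    ¬ IsIdRigid (Core (HolMonoidPair (AutHolFieldFunctor.ofGaloisCategory G) T)) :=
  not_isIdRigid_core hT X z hz hc

end HolMonoidPair

namespace AbsTopIII

variable {G} in
/-- **[AbsTopIII] Cor 4.5 (i)–(v) for `𝒳 := 𝒞^hol_TM` at the Galois-category instance**, from an object of
`B(G)` and the SLIMNESS of `G` (id-rigidity of `EA` by the printed route; then abc-iut-w5-d226's
`cor_4_5_arch_TM`). [cite: MochizukiAbsTopIII2015, Corollary 4.5 pp.107–109] -/
theorem cor_4_5_arch_TM_ofGaloisCategory [IsTopologicalGroup G] [CompactSpace G] [T2Space G]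
    [TotallyDisconnectedSpace G] (hG : IsSlimGroup G) (X₀ : BCat G) :
    Literature.AnabelianGeometry.AbsoluteAnabelian.AbsTopIII.Cor_4_5
      (archLogFrobeniusDataTM (AutHolFieldFunctor.ofGaloisCategory G))
      (archTelecoreDataTM (AutHolFieldFunctor.ofGaloisCategory G)) :=
  cor_4_5_arch_TM (AutHolFieldFunctor.ofGaloisCategory G) (AutHolFieldFunctor.objOfBCat G X₀)
    (AutHolFieldFunctor.isIdRigid_EA_ofGaloisCategory hG)

/-- **Cor 4.5 for `T = TM`, UNCONDITIONALLY, at `G := G_{ℚ_p}`** (slim: abc-iut-L4-t10 g3's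
`isSlimGroup_absoluteGaloisGroup_padic`; object `G/G`): all five items of the typed Cor 4.5 hold outright
for the `TM` model over `B(G_{ℚ_p})` — an `EA` with nontrivial automorphism groups, id-rigid by slimness.
[cite: MochizukiAbsTopIII2015, Corollary 4.5 pp.107–109] -/
theorem cor_4_5_arch_TM_absoluteGaloisGroup_padic (p : ℕ) [Fact p.Prime] :
    Literature.AnabelianGeometry.AbsoluteAnabelian.AbsTopIII.Cor_4_5
      (archLogFrobeniusDataTM (AutHolFieldFunctor.ofGaloisCategory (Field.absoluteGaloisGroup ℚ_[p])))
      (archTelecoreDataTM (AutHolFieldFunctor.ofGaloisCategory (Field.absoluteGaloisGroup ℚ_[p]))) := by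
  haveI : CompactSpace (Field.absoluteGaloisGroup ℚ_[p]) :=
    Literature.NumberTheory.GaloisRepresentations.absoluteGaloisGroup_compactSpace ℚ_[p]
  haveI : Subsingleton
      (Field.absoluteGaloisGroup ℚ_[p] ⧸ (⊤ : Subgroup (Field.absoluteGaloisGroup ℚ_[p]))) :=
    QuotientGroup.subsingleton_quotient_top
  haveI : Finite (Field.absoluteGaloisGroup ℚ_[p] ⧸ (⊤ : Subgroup (Field.absoluteGaloisGroup ℚ_[p]))) :=
    Finite.of_subsingleton
  exact cor_4_5_arch_TM_ofGaloisCategory (isSlimGroup_absoluteGaloisGroup_padic p)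
    (Induction.quotObj (⊤ : Subgroup (Field.absoluteGaloisGroup ℚ_[p])) isOpen_univ)

/-- The monoid-type categories over `B(G_{ℚ_p})` are id-rigid, unconditionally (Prop 4.2 (i) by slimness).
[cite: MochizukiAbsTopIII2015, Proposition 4.2 (i) p.106] -/
theorem isIdRigid_holMonoidPair_absoluteGaloisGroup_padic (p : ℕ) [Fact p.Prime] {T : ArchPairType}
    (hT : T.IsMonoidType) :
    IsIdRigid (HolMonoidPair (AutHolFieldFunctor.ofGaloisCategory (Field.absoluteGaloisGroup ℚ_[p])) T) := by
  haveI : CompactSpace (Field.absoluteGaloisGroup ℚ_[p]) :=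
    Literature.NumberTheory.GaloisRepresentations.absoluteGaloisGroup_compactSpace ℚ_[p]
  exact HolMonoidPair.isIdRigid_ofGaloisCategory _ hT (isSlimGroup_absoluteGaloisGroup_padic p)

end AbsTopIII

end Literature.AnabelianGeometry.AbsoluteAnabelian
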